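import Mathlib
import Literature.NumberTheory.Automorphic.HilbertModularFormQExpansion
import Summits.Langlands.Langlands.Theorems.CapacityClassicalityHilbertIntegralOverconvergentIsCongruenceStubHolNoZeroDivisors

/-!
# Slice derivatives of holomorphic functions on `ℍ^d`
(stub stub_slice_deriv_holomorphic of line Sketch-ideate-r1-k1)

Stub X1 of the crux `HilbertIntegralOverconvergentIsCongruence` (stmt-Langlands-8485).  For a
function `f` holomorphic on the product of upper half planes
`ℍ = halfSpace F ⊆ Point F = ℂ^{Hom(F,ℝ)}` and a real place `σ`, the slice derivative
`∂_σ f (z) := d/dt f(z with z_σ := t)|_{t = z_σ} = deriv (fun t ↦ f (update z σ t)) (z σ)`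
is again holomorphic on `ℍ`, and at every `z ∈ ℍ` the slice `t ↦ f (update z σ t)` has
derivative `Df(z)[e_σ] = fderiv ℂ f z (Pi.single σ 1)`.

Proof.  `ℍ` is open, so `f` is differentiable at every `z ∈ ℍ`; the chain rule with the affine
line `t ↦ update z σ t` (`hasDerivAt_update`; the line passes through `z` at `t = z_σ`) gives
the second clause.  For the first, on `ℍ` the slice derivative therefore equals
`z ↦ Df(z)[e_σ]`; by Osgood's lemma (`nzd_analyticOnNhd_of_isHolomorphicOn`) `f` is analytic on
the open set `ℍ`, hence so is `z ↦ Df(z)` (`AnalyticOnNhd.fderiv_of_isOpen`), and evaluating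
at the constant vector `e_σ` keeps differentiability on `ℍ`; conclude with
`DifferentiableOn.congr`.
-/

set_option linter.dupNamespace false

noncomputable section

namespace Summit.Langlands.Langlands.Theorems.HilbertIntegralOverconvergentIsCongruence

open MeasureTheory Complex NumberField
open Literature.NumberTheory.Automorphic Literature.NumberTheory.Automorphic.HilbertModular
open scoped MatrixGroups

open Classical in
/-- Chain rule along a coordinate line: if `f` is holomorphic on `ℍ` and `z ∈ ℍ`, the slice
`t ↦ f (update z σ t)` has derivative `Df(z)[e_σ]` at `t = z_σ` (the line `t ↦ update z σ t`
has derivative `e_σ = Pi.single σ 1` and passes through `z` at `t = z_σ`). [folklore] -/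
theorem sdh_hasDerivAt_slice {F : Type} [Field F] [NumberField F] (σ : F →+* ℝ)
    {f : Point F → ℂ} (hf : IsHolomorphicOn F f) {z : Point F} (hz : z ∈ halfSpace F) :
    HasDerivAt (fun t : ℂ ↦ f (Function.update z σ t)) (fderiv ℂ f z (Pi.single σ 1))
      (z σ) := by
  have hd : DifferentiableAt ℂ f z :=
    (hf z hz).differentiableAt (isOpen_halfSpace.mem_nhds hz)
  exact hd.hasFDerivAt.comp_hasDerivAt_of_eq (z σ) (hasDerivAt_update z σ (z σ))
    (Function.update_eq_self σ z).symm

open Classical in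
/-- For `f` holomorphic on `ℍ`, the directional derivative `z ↦ Df(z)[e_σ]` is holomorphic on
`ℍ`: `f` is analytic on the open set `ℍ` (Osgood), hence so is `Df`, and evaluation at the
constant vector `e_σ` preserves differentiability. [folklore] -/
theorem sdh_differentiableOn_fderiv_apply {F : Type} [Field F] [NumberField F] (σ : F →+* ℝ)
    {f : Point F → ℂ} (hf : IsHolomorphicOn F f) :
    DifferentiableOn ℂ (fun z ↦ fderiv ℂ f z (Pi.single σ 1)) (halfSpace F) := by
  have hA : AnalyticOnNhd ℂ (fderiv ℂ f) (halfSpace F) :=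
    (nzd_analyticOnNhd_of_isHolomorphicOn hf).fderiv_of_isOpen isOpen_halfSpace
  exact hA.differentiableOn.clm_apply (differentiableOn_const _)

open Classical in
/-- **stub X1 — `stub_slice_deriv_holomorphic` (M; partial derivatives of holomorphic functions on `ℍ^d`).** For `f` holomorphic
on `ℍ = halfSpace F` and a place `σ`, the slice derivative `∂_σ f (z) := d/dt f(z with z_σ := t)|_{t = z_σ}` is again holomorphic on
`ℍ`, and at every `z ∈ ℍ` the slice `t ↦ f(update z σ t)` has derivative `Df(z)[e_σ]` (chain rule with the affine map
`t ↦ update z σ t`, `hasDerivAt_update`; holomorphy of `z ↦ Df(z)[e_σ]` from analyticity on the open set `ℍ`, Osgood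
`nzd_analyticOnNhd_of_isHolomorphicOn` + `AnalyticAt.fderiv`). [folklore] -/
theorem stub_slice_deriv_holomorphic (F : Type) [Field F] [NumberField F] (σ : F →+* ℝ) (f : Point F → ℂ)
    (hf : IsHolomorphicOn F f) :
    IsHolomorphicOn F (fun z ↦ deriv (fun t : ℂ ↦ f (Function.update z σ t)) (z σ)) ∧
    ∀ z ∈ halfSpace F,
      HasDerivAt (fun t : ℂ ↦ f (Function.update z σ t)) (fderiv ℂ f z (Pi.single σ 1)) (z σ) := by
  refine ⟨?_, fun z hz ↦ sdh_hasDerivAt_slice σ hf hz⟩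
  change DifferentiableOn ℂ (fun z ↦ deriv (fun t : ℂ ↦ f (Function.update z σ t)) (z σ))
    (halfSpace F)
  exact (sdh_differentiableOn_fderiv_apply σ hf).congr fun z hz ↦
    (sdh_hasDerivAt_slice σ hf hz).deriv

end Summit.Langlands.Langlands.Theorems.HilbertIntegralOverconvergentIsCongruence
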